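import Summits.Schanuel.Schanuel.Theorems.RootDecomp1KCubicDescent04

/-!
# RootDecomp1KCubicDescent — lens 1, generation 59, NODE 20 «3-DESCENT ON THE K-LINE» (Chevalley–Weil through the ℚ-rational 3-torsion μ₃-cover, Runge function w + 2 upstairs; RULE K-R50 (iii) payable clause; CLAIM L2763, PRICE L2766, K-R51) — continuation (RootDecomp1KCubicDescent05): §7 TERRITORY of CJ j by tree names (section Territory)

(lens-1 g59 NODE 20 HOME kernel K = HOME/decomp-schanuel-lens-1/g59/Cubic.lean eea76fbb…, 1125 l, imports tree …RootDecomp1KDescent06 ONLY = the port of node 19 (no Literature import, no fact def, no private, no set_option, no structure, no axiom / instance / sorry / native_decide); Probe / Ctrl0 / Ctrl + NODE-g59.md + SHA256SUMS; CLAIM L2763, writer g30 pre-kernel re-verification L2769, crit g10 EX-ANTE PRICE L2766 (ONE THEOREM ×1 for (A) descent lemma + (B) the uniform theorem thinFibreAt_CB over ℤ⁴ + (C) class/territory CJ j JOINTLY iff CHECKLIST K-g59 (1)–(10); RULE K-R51 pre-announced), census LIVENESS-v12/v13/v14 L2765/L2767/L2771 (node-20 rows; keys cub3 / frob / tors / jroot;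 of record L2766/L2768/L2772), NODE L2775, critic VERDICT L2777 (crit g10): CLEARED — THEOREM ×1 for (A) the descent lemma + (B) the uniform theorem thinFibreAt_CB over ℤ⁴ + (C) class/territory CJ j JOINTLY under RULE K-R50 (iii), CHECKLIST K-g59 (1)–(10) met, rung 0; LABEL OF RECORD: literature = VARIANT of a KNOWN TOOL (Chevalley–Weil through a rational-3-torsion μ₃-cover + Runge upstairs: Schaefer 1998 / Levin 2008 Thm 6 made explicit); RULE K-R51 FIXED (toolkit of record ∪= DESCENT IN GENERAL — every further descent-built member / family / torsion order ℓ / engine ×0-as-record; OPEN TERRITORY at m₀ = 2 := K-R49 territory ∧ NO ℚ-rational descent datum, k = 2 certificate = census LIVENESS keys j2rat none ∧ jroot(ℓ) none for ℓ ∈ {2,3,5,7,11} ∧ tors; standing witness W4 certified for ℓ ≤ 11; UNCONDITIONAL PART ∪= CB(ℤ⁴) at ThinFibreAt m₀ ≥ 2); TALLY lens-1 ×17 + THEOREM ×19; PORT GO exactly as census STAGING NOTES 10/10b L2774/L2776 (lens concurred L2775) with the edits (a) + (b) + (c) SANCTIONED. Port by census-1 gen 23 as `RootDecomp1KCubicDescent01–05`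 (`--supports stmt-Schanuel-33364`; no census credit): 01 = §0 helpers, §1 the family `CB h₁ h₀ l₁ l₀ = xPolyP 2 (cbC …)` (`cbH`, `cbL`, `cbC`, `bev_CB`), §2 the level equation in integers; 02 = §3 THE DESCENT LEMMA (pure ℤ-arithmetic, six named steps: `dvd_p_of_level`, `dvd_H_of_level`, `even_h_of_level`, `isCoprime_twist`, `eq_cube_of_coprime_cb`, `two_pow_dvd_add_of_cube_cb`; `descent_cb`); 03 = §4 THE ENGINE **`thinFibreAt_CB (h₁ h₀ l₁ l₀ : ℤ) (hm : 2 ≤ m₀) : ThinFibreAt m₀ (CB h₁ h₀ l₁ l₀)`** HYPOTHESIS-FREE, uniform over ℤ⁴ (the Runge function on the μ₃-cover is w + 2); 04 = §5 class data (`xDisc`, `CJ j := CB 0 5 5 (10 + 600 j)`, `cjQ`, `cjD`) and §6 the RABIN certificate mod 3 + Gauss: `Irreducible ((xDisc (CJ j)).map ℚ)` uniformly in j; 05 = §7 TERRITORY (section Territory): `CJ_territory`, named members CJ0 / CJ1. PORT EDITS: (a) 33 one-line docstrings quoting the signature on the undocumented decls (`cbC_two` / `cbC_one` / `cbC_zero`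 / `cbC_of_gt`, `aeval_cbH`, `aeval_cbL`, `monic_cbH`, `cbH_ne_zero`, `natDegree_cjD`, `coeff_cjD_six/five/four`, `leadingCoeff_cjD`, `ra2` … `re3`, `natDegree_cbH`, `natDegree_cbC_zero`, `natDegree_cbC_one_055`, `coeff_zero_cbC_two_055`, `monic_cjQ`, `natDegree_cjQ`, `cjQ_ne_zero`, `coeff_four_cjQ`, `cbC_two_055_ne_zero`, `bzB`, `bzM`, `bzW`, `thinFibreAt_two_CJ1`, `CJ0_territory`); (b) PRIVATISATION ×2 of the §0 one-liners that the head dry-run BOUNCED as dedup.landed twins of importable out-of-cone declarations — `isCoprime_num_den_cb` (≡ `Literature.NumberTheory.DiophantineApproximation.isCoprime_num_den`) and `odd_psNumer_cb` (≡ `RootDecomp1KCollarCell.odd_psNumer_two`, CollarCell02 = +53 modules) — with file-local private copies in 03 where §4's `thinFibreAt_CB` uses them; (c) K's import line moved ABOVE its 4-line copyright comment (the part-01 provenance module docstring must follow the import; comment kept verbatim); nothing else (no deletion, no replacement of a statement, no import added, no set_option; K's `@[simp]` kept); provenance doc blocks + continuation headers = K's own open-lines; statements and proofs VERBATIM. Rung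 0 — nothing here proves Schanuel, 33364, 33363, 31077 or ThinFibre 2; everything HYPOTHESIS-FREE.)
-/

noncomputable section

namespace Summit.Schanuel.Schanuel.Theorems.RootDecomp1KCubicDescent

open Polynomial LiouvilleNumber
open scoped Nat
open Summit.Schanuel.Schanuel.Theorems.RootDecomp1KTwoBaseCell (psNumer partialSum_eq_psNumer_div coprime_psNumer)
open Summit.Schanuel.Schanuel.Theorems.RootDecomp1KDegreeLadder
open Summit.Schanuel.Schanuel.Theorems.RootDecomp1KXLinear
open Summit.Schanuel.Schanuel.Theorems.RootDecomp1KXLinearII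
open Summit.Schanuel.Schanuel.Theorems.RootDecomp1KXTop
open Summit.Schanuel.Schanuel.Theorems.RootDecomp1KXAll
open Summit.Schanuel.Schanuel.Theorems.RootDecomp1KLevelFinite
open Summit.Schanuel.Schanuel.Theorems.RootDecomp1KThueMahler
open Summit.Schanuel.Schanuel.Theorems.RootDecomp1KParamThueMahler
open Summit.Schanuel.Schanuel.Theorems.RootDecomp1KLocalExponent
open Summit.Schanuel.Schanuel.Theorems.RootDecomp1KIntegrality (GaussAt gaussAt_xPolyP_iff)
open Summit.Schanuel.Schanuel.Theorems.RootDecomp1KSubspaceBranch (SepTopAt)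
open Summit.Schanuel.Schanuel.Theorems.RootDecomp1KRunge
open Summit.Schanuel.Schanuel.Theorems.RootDecomp1KDescent

/-! ### §7 TERRITORY of `CJ j` by TREE NAMES (K-R49 (ii) conjunction, as node 19's `DJ_territory`) -/

section Territory

/-- `(h₁ h₀ : ℤ) : (cbH h₁ h₀).natDegree = 2`. -/
theorem natDegree_cbH (h₁ h₀ : ℤ) : (cbH h₁ h₀).natDegree = 2 := by unfold cbH; compute_degree!
/-- `(h₁ h₀ l₁ l₀ : ℤ) : (cbC h₁ h₀ l₁ l₀ 0).natDegree = 2`. -/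
theorem natDegree_cbC_zero (h₁ h₀ l₁ l₀ : ℤ) : (cbC h₁ h₀ l₁ l₀ 0).natDegree = 2 := by
  rw [cbC_zero, natDegree_neg, natDegree_cbH]
/-- `c₁ = 4 − L·H` of `CB(0,5,5,λ)` in normal form. -/
theorem cbC_one_055_eq (l : ℤ) :
    cbC 0 5 5 l 1 = C (-5) * X ^ 3 + C (-l) * X ^ 2 + C (-25) * X + C (4 - 5 * l) := by
  simp only [cbC_one, cbH, cbL, map_zero, zero_mul, add_zero, map_mul, map_neg, map_sub, map_ofNat]
  ring
/-- `(l : ℤ) : (cbC 0 5 5 l 1).natDegree = 3`. -/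
theorem natDegree_cbC_one_055 (l : ℤ) : (cbC 0 5 5 l 1).natDegree = 3 := by
  rw [cbC_one_055_eq]; compute_degree!
/-- `(cbC 0 5 5 λ 1).coeff 0 = 4 − 5λ` and `(cbC 0 5 5 λ 2).coeff 0 = 25 + 4λ`. -/
theorem coeff_zero_cbC_one_055 (l : ℤ) : (cbC 0 5 5 l 1).coeff 0 = 4 - 5 * l := by
  rw [cbC_one_055_eq]; simp only [coeff_add, coeff_C_mul_X_pow, coeff_C_mul_X, coeff_C]; norm_num
/-- `(l : ℤ) : (cbC 0 5 5 l 2).coeff 0 = 25 + 4 * l`. -/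
theorem coeff_zero_cbC_two_055 (l : ℤ) : (cbC 0 5 5 l 2).coeff 0 = 25 + 4 * l := by
  rw [cbC_two_eq_cjQ, cjQ]; simp only [coeff_add, coeff_X_pow, coeff_C_mul_X_pow, coeff_C_mul_X, coeff_C]; norm_num

/-- `(l : ℤ) : (cjQ l).Monic`. -/
theorem monic_cjQ (l : ℤ) : (cjQ l).Monic := by unfold cjQ; monicity!
/-- `(l : ℤ) : (cjQ l).natDegree = 4`. -/
theorem natDegree_cjQ (l : ℤ) : (cjQ l).natDegree = 4 := by unfold cjQ; compute_degree!
/-- `(l : ℤ) : cjQ l ≠ 0`. -/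
theorem cjQ_ne_zero (l : ℤ) : cjQ l ≠ 0 := (monic_cjQ l).ne_zero
/-- `(l : ℤ) : (cjQ l).coeff 4 = 1`. -/
theorem coeff_four_cjQ (l : ℤ) : (cjQ l).coeff 4 = 1 := by
  rw [← natDegree_cjQ l]; exact (monic_cjQ l).coeff_natDegree
/-- `(l : ℤ) : cbC 0 5 5 l 2 ≠ 0`. -/
theorem cbC_two_055_ne_zero (l : ℤ) : cbC 0 5 5 l 2 ≠ 0 := by rw [cbC_two_eq_cjQ]; exact cjQ_ne_zero l

/-- `Q_j = Y⁴ + 10Y² + 20Y + (65 + 2400j)` is EISENSTEIN at `5` (`65 + 2400j ≡ 15 (mod 25)`). -/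
theorem isEisensteinAt_cjQ (j : ℕ) : (cjQ (cjLam j)).IsEisensteinAt (Ideal.span {(5 : ℤ)}) := by
  refine ⟨?_, fun {n} hn => ?_, ?_⟩
  · rw [(monic_cjQ _).leadingCoeff, Ideal.mem_span_singleton]; norm_num
  · rw [natDegree_cjQ] at hn
    rw [Ideal.mem_span_singleton]
    interval_cases n
    · rw [cjQ]; simp only [coeff_add, coeff_X_pow, coeff_C_mul_X_pow, coeff_C_mul_X, coeff_C, cjLam]; norm_num; omega
    · rw [cjQ]; simp only [coeff_add, coeff_X_pow, coeff_C_mul_X_pow, coeff_C_mul_X, coeff_C]; norm_num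
    · rw [cjQ]; simp only [coeff_add, coeff_X_pow, coeff_C_mul_X_pow, coeff_C_mul_X, coeff_C]; norm_num
    · rw [cjQ]; simp only [coeff_add, coeff_X_pow, coeff_C_mul_X_pow, coeff_C_mul_X, coeff_C]; norm_num
  · rw [Ideal.span_singleton_pow, Ideal.mem_span_singleton, cjQ]
    simp only [coeff_add, coeff_X_pow, coeff_C_mul_X_pow, coeff_C_mul_X, coeff_C, cjLam]; norm_num; omega

/-- … hence irreducible in `ℤ[Y]` … -/
theorem irreducible_cjQ (j : ℕ) : Irreducible (cjQ (cjLam j)) :=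
  (isEisensteinAt_cjQ j).irreducible ((Ideal.span_singleton_prime (by norm_num)).mpr
    (Int.prime_iff_natAbs_prime.mpr (by norm_num)))
    (monic_cjQ _).isPrimitive (by rw [natDegree_cjQ]; norm_num)

/-- … hence IRREDUCIBLE OVER `ℚ` (Gauss) … -/
theorem irreducible_cjQ_rat (j : ℕ) : Irreducible ((cjQ (cjLam j)).map (Int.castRingHom ℚ)) := by
  rw [← algebraMap_int_eq]
  exact ((monic_cjQ _).irreducible_iff_irreducible_map_fraction_map).mp (irreducible_cjQ j)

/-- … hence separable over `ℚ` … -/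
theorem separable_cjQ_rat (j : ℕ) : ((cjQ (cjLam j)).map (Int.castRingHom ℚ)).Separable :=
  (irreducible_cjQ_rat j).separable

/-- … hence NO RATIONAL ROOT. -/
theorem aeval_cjQ_ne_zero_rat (j : ℕ) (q : ℚ) : aeval q (cjQ (cjLam j)) ≠ 0 := by
  intro h
  have hroot : IsRoot ((cjQ (cjLam j)).map (Int.castRingHom ℚ)) q := by
    rw [IsRoot.def, eval_map, ← algebraMap_int_eq, ← aeval_def, h]
  have h1 := degree_eq_one_of_irreducible_of_root (irreducible_cjQ_rat j) hroot
  have h4 : ((cjQ (cjLam j)).map (Int.castRingHom ℚ)).degree = 4 := by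
    rw [degree_map_eq_of_injective (Int.castRingHom ℚ).injective_int, degree_eq_natDegree (cjQ_ne_zero _),
      natDegree_cjQ]
    rfl
  rw [h4] at h1
  exact absurd h1 (by decide)

/-- `Q_j` HAS A ROOT IN `ℚ₂`: HENSEL at `a = 1`: `‖Q_j(1)‖₂ = ‖32·(3 + 75j)‖₂ ≤ 2⁻⁵ < 2⁻⁴ = ‖44‖₂² = ‖Q_j'(1)‖₂²`. -/
theorem exists_padic_root_cjQ (j : ℕ) : ∃ z : ℚ_[2], aeval z (cjQ (cjLam j)) = 0 := by
  have hF : ‖aeval (1 : ℤ_[2]) (cjQ (cjLam j))‖ < ‖aeval (1 : ℤ_[2]) (derivative (cjQ (cjLam j)))‖ ^ 2 := by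
    have e1 : aeval (1 : ℤ_[2]) (cjQ (cjLam j)) = ((32 * (3 + 75 * (j : ℤ)) : ℤ) : ℤ_[2]) := by
      simp [cjQ, cjLam, map_ofNat]; ring
    have e2 : aeval (1 : ℤ_[2]) (derivative (cjQ (cjLam j))) = ((44 : ℤ) : ℤ_[2]) := by
      simp [cjQ, cjLam, map_ofNat]; norm_num
    rw [e1, e2]
    have h11 : ‖((11 : ℤ) : ℤ_[2])‖ = 1 := by
      refine le_antisymm (PadicInt.norm_le_one _) (not_lt.mp fun h => ?_)
      have := (PadicInt.norm_int_lt_one_iff_dvd _).mp h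
      omega
    have h2 : ‖(2 : ℤ_[2])‖ = (2 : ℝ)⁻¹ := by
      have := PadicInt.norm_p (p := 2)
      simpa using this
    have h44 : ‖((44 : ℤ) : ℤ_[2])‖ = (4 : ℝ)⁻¹ := by
      have e : ((44 : ℤ) : ℤ_[2]) = (2 : ℤ_[2]) ^ 2 * ((11 : ℤ) : ℤ_[2]) := by push_cast; norm_num
      rw [e, norm_mul, norm_pow, h11, h2]; norm_num
    have h32 : ‖((32 * (3 + 75 * (j : ℤ)) : ℤ) : ℤ_[2])‖ ≤ (2 : ℝ) ^ (-(5 : ℕ) : ℤ) := by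
      have := (PadicInt.norm_int_le_pow_iff_dvd (p := 2) (k := 32 * (3 + 75 * (j : ℤ))) (n := 5)).mpr
        ⟨3 + 75 * (j : ℤ), by ring⟩
      exact_mod_cast this
    rw [h44]
    calc ‖((32 * (3 + 75 * (j : ℤ)) : ℤ) : ℤ_[2])‖ ≤ (2 : ℝ) ^ (-(5 : ℕ) : ℤ) := h32
      _ < ((4 : ℝ)⁻¹) ^ 2 := by norm_num
  obtain ⟨z, hz, -⟩ := hensels_lemma hF
  refine ⟨(z : ℚ_[2]), ?_⟩
  have := Polynomial.aeval_algebraMap_apply ℚ_[2] z (cjQ (cjLam j))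
  rw [hz, map_zero] at this
  simpa using this

/-- the top `Q_j` is REFUSED by node 14's root condition at `m₀ ≤ 2` (tree `not_rootCond_of_padic_root`). -/
theorem not_rootCond_cjQ (j : ℕ) {m₀ : ℕ} (hm : m₀ ≤ 2) : ¬ RootCond m₀ (cjQ (cjLam j)) := by
  obtain ⟨z, hz⟩ := exists_padic_root_cjQ j
  exact not_rootCond_of_padic_root _ (cjQ_ne_zero _) hz (aeval_cjQ_ne_zero_rat j) hm

/-- `(j : ℕ) : CJ j = CB 0 5 5 (10 + 600 * j)` — rfl pin. -/
theorem CJ_eq (j : ℕ) : CJ j = CB 0 5 5 (10 + 600 * j) := rfl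
/-- `(j : ℕ) : xdeg (CJ j) = 2`. -/
theorem xdeg_CJ (j : ℕ) : xdeg (CJ j) = 2 := by rw [CJ, CB]; exact xdeg_xPolyP 2 _ (cbC_two_055_ne_zero _)
/-- `(j : ℕ) : topX (CJ j) = cjQ (cjLam j)` — the top `x`-coefficient is `Q_j`. -/
theorem topX_CJ (j : ℕ) : topX (CJ j) = cjQ (cjLam j) := by
  rw [CJ, CB, topX_xPolyP 2 _ (cbC_two_055_ne_zero _), cbC_two_eq_cjQ]
/-- `(j : ℕ) (i : ℕ) : xCoeff (CJ j) i = cbC 0 5 5 (cjLam j) i`. -/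
theorem xCoeff_CJ (j i : ℕ) : xCoeff (CJ j) i = cbC 0 5 5 (cjLam j) i := by rw [CJ, xCoeff_CB]
/-- `(j : ℕ) : 4 ≤ (CJ j).natDegree` (the `Y⁴x²` coefficient is `1`). -/
theorem four_le_natDegree_CJ (j : ℕ) : 4 ≤ (CJ j).natDegree := by
  refine le_natDegree_of_ne_zero fun h => ?_
  have h1 := congrArg (fun q : ℤ[X] => q.coeff 2) h
  simp only [CJ, CB, coeff_coeff_xPolyP, coeff_zero] at h1
  rw [if_pos (by simp), cbC_two_eq_cjQ, coeff_four_cjQ] at h1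
  exact one_ne_zero h1
/-- `(j : ℕ) : (CJ j).natDegree = 4`. -/
theorem natDegree_CJ (j : ℕ) : (CJ j).natDegree = 4 := by
  refine le_antisymm ?_ (four_le_natDegree_CJ j)
  rw [CJ, CB]
  refine natDegree_xPolyP_le 2 _ 4 fun i hi => ?_
  interval_cases i
  · rw [natDegree_cbC_zero]; norm_num
  · rw [natDegree_cbC_one_055]; norm_num
  · rw [cbC_two_eq_cjQ, natDegree_cjQ]
/-- `(j : ℕ) : CJ j ≠ 0`. -/
theorem CJ_ne_zero (j : ℕ) : CJ j ≠ 0 := fun h => by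
  have := four_le_natDegree_CJ j; rw [h, natDegree_zero] at this; omega
/-- `(j : ℕ) : eTop (CJ j) = 0` — FULL-DEGREE top. -/
theorem eTop_CJ (j : ℕ) : eTop (CJ j) = 0 := by rw [eTop, natDegree_CJ, topX_CJ, natDegree_cjQ]
/-- `(j : ℕ) : (topX (CJ j)).natDegree = (CJ j).natDegree`. -/
theorem natDegree_topX_CJ (j : ℕ) : (topX (CJ j)).natDegree = (CJ j).natDegree := by
  rw [topX_CJ, natDegree_cjQ, natDegree_CJ]
/-- `(j : ℕ) : ¬ (CJ j).natDegree < 2 * xdeg (CJ j)` — OUTSIDE node 12's height shape (`4 = 2·2`). -/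
theorem not_natDegree_CJ_lt (j : ℕ) : ¬ (CJ j).natDegree < 2 * xdeg (CJ j) := by
  rw [natDegree_CJ, xdeg_CJ]; norm_num

/-- [datum] RATE-1 BEZOUT certificate (generator `gen59.py`): `bzA_λ·c₂ + bzB_λ·c₁ = m(λ)`, `m(1+3t) = 3·w(t) + 1 ≠ 0`. -/
def bzA (l : ℤ) : ℤ[X] :=
  C ((325000) + (-15625) * l + (-296) * l ^ 2 + (1) * l ^ 5) + C ((-78125) + (1040) * l + (-1250) * l ^ 2 + (-5) * l ^ 4) * X + C ((67600) + (-6250) * l + (-50) * l ^ 3) * X ^ 2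

/-- `(l : ℤ) : ℤ[X]`. -/
def bzB (l : ℤ) : ℤ[X] :=
  C ((203091) + (-51480) * l + (-296) * l ^ 3 + (5) * l ^ 4) + C ((132600) + (-6250) * l + (440) * l ^ 2 + (-50) * l ^ 3) * X + C ((-15625) + (-2496) * l + (1) * l ^ 4) * X ^ 2 + C ((13520) + (-1250) * l + (-10) * l ^ 3) * X ^ 3

/-- `(l : ℤ) : ℤ`. -/
def bzM (l : ℤ) : ℤ :=
  (8937364) + (-312000) * l + (187500) * l ^ 2 + (-2368) * l ^ 3 + (1500) * l ^ 4 + (4) * l ^ 6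

/-- `(t : ℤ) : ℤ`. -/
def bzW (t : ℤ) : ℤ :=
  (2937333) + (61920) * t + (568368) * t ^ 2 + (33408) * t ^ 3 + (42120) * t ^ 4 + (1944) * t ^ 5 + (972) * t ^ 6

/-- `(l : ℤ) : bzA l * cbC 0 5 5 l 2 + bzB l * cbC 0 5 5 l 1 = C (bzM l)`. -/
theorem bezout_cj (l : ℤ) : bzA l * cbC 0 5 5 l 2 + bzB l * cbC 0 5 5 l 1 = C (bzM l) := by
  simp only [bzA, bzB, bzM, cbC_two, cbC_one, cbH, cbL, map_zero, zero_mul, add_zero, map_add, map_mul, map_pow,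
    map_neg, map_ofNat, one_mul]
  ring
/-- `(t : ℤ) : bzM (1 + 3 * t) = 3 * bzW t + 1`. -/
theorem bzM_eq (t : ℤ) : bzM (1 + 3 * t) = 3 * bzW t + 1 := by simp only [bzM, bzW]; ring
/-- `(j : ℕ) : bzM (cjLam j) ≠ 0` (`≡ 1 (mod 3)`). -/
theorem bzM_cjLam_ne_zero (j : ℕ) : bzM (cjLam j) ≠ 0 := by rw [cjLam_eq, bzM_eq]; omega

/-- RATE 1, TYPED: at every root `β` of the top `Q_j` (in any field of characteristic `0`) the `x¹`-coefficient
`c₁ = 4 − L·H` does not vanish (Bezout: `bzB(β)·c₁(β) = m(λ_j) ≠ 0`). -/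
theorem aeval_xCoeff_one_ne_zero_of_root_CJ (j : ℕ) (K : Type) [Field K] [CharZero K] (β : K)
    (hβ : aeval β (topX (CJ j)) = 0) : aeval β (xCoeff (CJ j) 1) ≠ 0 := by
  rw [topX_CJ, ← cbC_two_eq_cjQ] at hβ
  rw [xCoeff_CJ]
  intro h1
  have h := congrArg (aeval β) (bezout_cj (cjLam j))
  simp only [map_add, map_mul, hβ, h1, mul_zero, add_zero, eq_intCast, map_intCast] at h
  exact Int.cast_ne_zero.mpr (bzM_cjLam_ne_zero j) h.symm

/-- `CJ j` has NO x-linear presentation (second difference of `P_j(x, 0) = (65+2400j)x² + …` in `x` is `≠ 0`). -/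
theorem CJ_ne_xLinP (j : ℕ) (A B : ℤ[X]) : CJ j ≠ xLinP A B := by
  intro hP
  have h := fun x : ℝ => congrArg (fun Q => bev Q x 0) hP
  have h0 := h 0
  have h1 := h 1
  have h2 := h 2
  simp only [CJ, bev_CB, bev_xLinP, cjLam] at h0 h1 h2
  push_cast at h0 h1 h2
  have : (130 + 4800 * (j : ℝ) : ℝ) = 0 := by linear_combination h0 - 2 * h1 + h2
  norm_cast at this; omega
/-- `(j : ℕ) : ¬ XLinearLt (CJ j)`. -/
theorem not_xLinearLt_CJ (j : ℕ) : ¬ XLinearLt (CJ j) := fun ⟨A, B, _, _, hP⟩ => CJ_ne_xLinP j A B hP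
/-- outside node 16's record class (x-linear by statement). -/
theorem not_xLinTM_CJ (j : ℕ) : ¬ XLinTM (CJ j) := fun ⟨A, B, _, _, _, _, hP⟩ => CJ_ne_xLinP j A B hP
/-- not a conjugate-poles norm shape of node 10 (those are x-linear). -/
theorem CJ_ne_normShapeCurve (j : ℕ) (g q : ℤ[X]) (n : ℕ) (D : ℤ) : CJ j ≠ normShapeCurve g q n D := by
  rw [normShapeCurve_eq_xLinP]; exact CJ_ne_xLinP j _ _
/-- not a two-term curve `x^k·B(Y) − A(Y)` (the `x`-support of `CJ j` is `{0, 1, 2}`: `c₂(0) = 65 + 2400j ≠ 0`,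
`c₁(0) = −46 − 3000j ≠ 0`). -/
theorem CJ_ne_twoTermP (j : ℕ) (k : ℕ) (B A : ℤ[X]) : CJ j ≠ twoTermP k B A := by
  intro h
  have hc : ∀ i i' : ℕ, (if i' ∈ Finset.range 3 then (cbC 0 5 5 (cjLam j) i').coeff i else 0) =
      ((if i' = k then B.coeff i else 0) - (if i' = 0 then A.coeff i else 0)) := by
    intro i i'
    rw [← coeff_coeff_xPolyP, ← coeff_coeff_twoTermP, ← h]; rfl
  by_cases hk : k = 1
  · subst hk
    have h02 := hc 0 2
    rw [if_pos (by simp), if_neg (by norm_num), if_neg (by norm_num), coeff_zero_cbC_two_055, cjLam] at h02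
    omega
  · have h01 := hc 0 1
    rw [if_pos (by simp), if_neg (fun h => hk h.symm), if_neg (by norm_num), coeff_zero_cbC_one_055, cjLam] at h01
    omega
/-- in EVERY presentation `CJ j = Σ_{i ≤ k} x^i c_i(Y)` the top has a `ℚ₂`-root (it is `Q_j` or `0`). -/
theorem exists_padic_root_top_of_CJ_eq (j : ℕ) (k : ℕ) (c : ℕ → ℤ[X]) (h : CJ j = xPolyP k c) :
    ∃ z : ℚ_[2], aeval z (c k) = 0 := by
  by_cases hck : c k = 0
  · exact ⟨0, by rw [hck, map_zero]⟩
  · have h1 := topX_CJ j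
    rw [h, topX_xPolyP k c hck] at h1
    rw [h1]; exact exists_padic_root_cjQ j
/-- `(j : ℕ) (e : ℕ) : ¬ RootlessTop e (CJ j)`. -/
theorem not_rootlessTop_CJ (j : ℕ) (e : ℕ) : ¬ RootlessTop e (CJ j) := by
  rintro ⟨k, c, -, hroot, h⟩
  obtain ⟨z, hz⟩ := exists_padic_root_top_of_CJ_eq j k c h
  exact hroot z hz
/-- **`¬ DecidedAt 2 (CJ j)`** — each of the five disjuncts of the record's decided class refuted. -/
theorem not_decidedAt_two_CJ (j : ℕ) : ¬ DecidedAt 2 (CJ j) := by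
  rintro (h | h | h | h | h)
  · have := four_le_natDegree_CJ j; omega
  · exact not_xLinearLt_CJ j h
  · exact absurd h.1 (by norm_num)
  · have := three_le_thinThreshold (CJ j); omega
  · exact not_rootlessTop_CJ j 1 h
/-- **`¬ LocalAt m₀ (CJ j)` for `m₀ ≤ 2`** (tree `rootCond_topX_of_localAt` + `not_rootCond_cjQ`). -/
theorem not_localAt_CJ (j : ℕ) {m₀ : ℕ} (hm : m₀ ≤ 2) : ¬ LocalAt m₀ (CJ j) := fun h => by
  have hR := rootCond_topX_of_localAt h
  rw [topX_CJ] at hR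
  exact not_rootCond_cjQ j hm hR
/-- **`¬ GaussAt m₀ (CJ j)`** at ANY `m₀` (dominance fails at `i = 1`: `deg c₁ = 3 > 2 = deg c₀`). -/
theorem not_gaussAt_CJ (j : ℕ) (m₀ : ℕ) : ¬ GaussAt m₀ (CJ j) := by
  intro h
  rw [CJ, CB] at h
  have := ((gaussAt_xPolyP_iff 2 (cbC 0 5 5 (cjLam j)) (cbC_two_055_ne_zero _)).mp h).1 1 le_rfl (by norm_num)
  rw [natDegree_cbC_one_055, natDegree_cbC_zero] at this
  omega
/-- … while `CJ j` IS in node 11's CONDITIONAL class at `m₀ = 2` (separable top, `eTop = 0`; HONEST: conditional of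
record via `PadicSubspace`, which is NOT proved here — the 3-descent BYPASSES it). -/
theorem sepTopAt_two_CJ (j : ℕ) : SepTopAt 2 (CJ j) := by
  refine ⟨?_, ?_⟩
  · rw [topX_CJ]; exact separable_cjQ_rat j
  · rw [eTop_CJ]; norm_num

/-- **`CJ` is INJECTIVE** — an INFINITE class (the `x²Y⁰` coefficient is `65 + 2400j`). -/
theorem CJ_injective : Function.Injective CJ := by
  intro j₁ j₂ h
  have h1 := congrArg (fun P => (xCoeff P 2).coeff 0) h
  simp only [xCoeff_CJ, coeff_zero_cbC_two_055, cjLam] at h1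
  omega

/-- **THE INFINITE CLASS `CJ j` OF K-R50-TERRITORY PAIRS MADE UNCONDITIONAL — TERRITORY AND THE THEOREM, uniformly
in `j`, by tree names:** the K-R49 (ii) conjunction exactly as node 19's `DJ_territory` (`x`-degree 2, `Y`-degree
`4 = 2·xdeg`, top `Q_j` ℚ-IRREDUCIBLE of FULL degree with a `ℚ₂`-root and no rational root, separable, `eTop = 0`, rate 1
typed, `¬ DecidedAt 2`, `¬ LocalAt 2`, `∀ m₀ ¬ GaussAt m₀`, `¬ XLinTM`, `¬ XLinearLt`, not x-linear / two-term / norm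
shape, `3 ≤ thinThreshold`, `SepTopAt 2` HONEST «binder bypassed, not proved») ∧ THE K-R50 (ii) CERTIFICATE TYPED ON
THE CURVE (`Δ_x = G² + 4H³` ℚ-irreducible of degree `6 ≡ 2 (mod 4)`: NO ℚ-rational 2-torsion, no 2-descent) ∧
`ThinFibreAt m₀ (CJ j)` for EVERY `m₀ ≥ 2`, HYPOTHESIS-FREE. -/
theorem CJ_territory (j : ℕ) :
    xdeg (CJ j) = 2 ∧ (CJ j).natDegree = 4 ∧ topX (CJ j) = cjQ (cjLam j) ∧
      Irreducible ((topX (CJ j)).map (Int.castRingHom ℚ)) ∧ (topX (CJ j)).natDegree = (CJ j).natDegree ∧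
      ¬ (CJ j).natDegree < 2 * xdeg (CJ j) ∧
      (∃ z : ℚ_[2], aeval z (topX (CJ j)) = 0) ∧ (∀ q : ℚ, aeval q (topX (CJ j)) ≠ 0) ∧
      ((topX (CJ j)).map (Int.castRingHom ℚ)).Separable ∧ eTop (CJ j) = 0 ∧
      (∀ (K : Type) [Field K] [CharZero K] (β : K), aeval β (topX (CJ j)) = 0 → aeval β (xCoeff (CJ j) 1) ≠ 0) ∧
      ¬ DecidedAt 2 (CJ j) ∧ ¬ LocalAt 2 (CJ j) ∧ (∀ m₀, ¬ GaussAt m₀ (CJ j)) ∧ ¬ XLinTM (CJ j) ∧ ¬ XLinearLt (CJ j) ∧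
      (∀ A B, CJ j ≠ xLinP A B) ∧ (∀ k B A, CJ j ≠ twoTermP k B A) ∧ (∀ g q n D, CJ j ≠ normShapeCurve g q n D) ∧
      3 ≤ thinThreshold (CJ j) ∧ SepTopAt 2 (CJ j) ∧
      xDisc (CJ j) = (cbL 5 (cjLam j) * cbH 0 5 + 4) ^ 2 + 4 * cbH 0 5 ^ 3 ∧
      Irreducible ((xDisc (CJ j)).map (Int.castRingHom ℚ)) ∧ (xDisc (CJ j)).natDegree = 6 ∧
      (xDisc (CJ j)).natDegree % 4 = 2 ∧
      ∀ m₀, 2 ≤ m₀ → ThinFibreAt m₀ (CJ j) := by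
  refine ⟨xdeg_CJ j, natDegree_CJ j, topX_CJ j, ?_, natDegree_topX_CJ j, not_natDegree_CJ_lt j, ?_, ?_, ?_, eTop_CJ j,
    aeval_xCoeff_one_ne_zero_of_root_CJ j, not_decidedAt_two_CJ j, not_localAt_CJ j le_rfl, not_gaussAt_CJ j,
    not_xLinTM_CJ j, not_xLinearLt_CJ j, CJ_ne_xLinP j, CJ_ne_twoTermP j, CJ_ne_normShapeCurve j,
    three_le_thinThreshold _, sepTopAt_two_CJ j, ?_, (irreducible_xDisc_CJ j).1, (irreducible_xDisc_CJ j).2.1,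
    (irreducible_xDisc_CJ j).2.2, fun m₀ hm => ?_⟩
  · rw [topX_CJ]; exact irreducible_cjQ_rat j
  · rw [topX_CJ]; exact exists_padic_root_cjQ j
  · rw [topX_CJ]; exact aeval_cjQ_ne_zero_rat j
  · rw [topX_CJ]; exact separable_cjQ_rat j
  · rw [CJ, xDisc_CB]
  · exact thinFibreAt_CB 0 5 5 (cjLam j) hm

/-- the NAMED MEMBERS `CJ0 = CB(0,5,5,10) = (Y⁴+10Y²+20Y+65)·x² + (4 − (5Y+10)(Y²+5))·x − (Y²+5)` and
`CJ1 = CB(0,5,5,610)`. -/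
theorem thinFibreAt_two_CJ0 : ThinFibreAt 2 (CJ 0) := thinFibreAt_CB 0 5 5 _ le_rfl
/-- `: ThinFibreAt 2 (CJ 1)`. -/
theorem thinFibreAt_two_CJ1 : ThinFibreAt 2 (CJ 1) := thinFibreAt_CB 0 5 5 _ le_rfl
/-- `: ¬ DecidedAt 2 (CJ 0) ∧ ¬ LocalAt 2 (CJ 0) ∧ ¬ GaussAt 2 (CJ 0) ∧ ¬ XLinTM (CJ 0) ∧ Irreducible ((topX (CJ 0)).map (Int.castRingHom ℚ)) ∧ (topX (CJ 0)).natDegree = (CJ 0).natDegree ∧ ¬ (CJ 0).natDegree < 2 * xdeg (CJ…`. -/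
theorem CJ0_territory : ¬ DecidedAt 2 (CJ 0) ∧ ¬ LocalAt 2 (CJ 0) ∧ ¬ GaussAt 2 (CJ 0) ∧ ¬ XLinTM (CJ 0) ∧
    Irreducible ((topX (CJ 0)).map (Int.castRingHom ℚ)) ∧ (topX (CJ 0)).natDegree = (CJ 0).natDegree ∧
    ¬ (CJ 0).natDegree < 2 * xdeg (CJ 0) ∧ Irreducible ((xDisc (CJ 0)).map (Int.castRingHom ℚ)) ∧
    (xDisc (CJ 0)).natDegree = 6 ∧ ThinFibreAt 2 (CJ 0) := by
  obtain ⟨-, -, -, h4, h5, h6, -, -, -, -, -, h12, h13, h14, h15, -, -, -, -, -, -, -, h23, h24, -, h26⟩ := CJ_territory 0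
  exact ⟨h12, h13, h14 2, h15, h4, h5, h6, h23, h24, h26 2 le_rfl⟩

end Territory

end Summit.Schanuel.Schanuel.Theorems.RootDecomp1KCubicDescent

end
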